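import Summits.BirchSwinnertonDyer.Rank1Residual.Additive.GordRamifiedOrdinaryLine
import Literature.NumberTheory.GaloisRepresentations.AbsGaloisGroupCompact
import Literature.NumberTheory.EllipticCurves.RootNumberTwistProofs
import HarnessLib

/-!
# The inertia group of the cyclotomic `ℤ_p`-tower at `p` still FLIPS `√p*`: an inertia element at `p`
# lying in `Gal(ℚ̄/ℚ_∞)` acts as `−1` on `√p*` (`p` odd) — the Galois input that makes the quotient
# `D = E[p^∞]/C` of every `e = 2` ramified ordinary datum (X4♯(G-ord, e = 2), X4(M), X3♯) have
# `D^{I_p ∩ G_{ℚ_∞}} = 0` (GV Remark (2.9)'s case) (cell `b2b-bsdres`, team n1011, seat p12 (gen 4);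
# row T-E3g-GV29, FILE 3; serves the displayed binder `h0` of `GreenbergVatsalTorsionRamifiedQuotient`)

HONEST FRAMING (cell `b2b-bsdres`, run/shared/lean/b2b/bsd-rank1-residual/, verbatim in every
file): the goal of the cell is to DELETE the COMBINATION-SHAPED residual classes of the
Birch–Swinnerton-Dyer formula for ALL analytic-rank `≤ 1` elliptic curves over `ℚ` — "full BSD
formula for every rank `≤ 1` curve in class `C`" assembled STRICTLY from published theorems — so
that the rank-`≤ 1` remainder becomes exactly the CONSTRUCTION-SHAPED classes, which are TYPED
(missing-input `Prop`s), NOT attempted. This is not "finishing BSD". Team n1011: research routes on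
CONSTRUCTION-SHAPED classes; prove what is provable now; no claim beyond stated classes; census
output = EVIDENCE, never a Literature fact; RESIDUAL-MAP marks UNCHANGED; nothing is booked by this
file. THEOREMS ONLY (Galois theory of `ℚ`; no curve): no definition, no named fact.

## What and why

At an additive prime `p` of semistability defect `e = 2` the cell's ramified ordinary datum `C ⊂ E[p^∞]`
is the TWIST TRANSPORT of the semistable datum of `V = E^{(p*)}` (p10 `Additive/RamifiedOrdinaryLineTransport`,
p07 `GaloisImage/RamifiedOrdinaryLineTwist`): on `D = E[p^∞]/C` inertia acts through the quadratic
character of `ℚ(√p*)`, trivially on `D_V` (reduction datum: `GreenbergVatsalReductionDatum`; Tate datum: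
`tateDatum_htriv`). GV Remark (2.9) (FILE 1 `GreenbergVatsalTorsionRamifiedQuotient`) needs
`D^{I} = 0` for the inertia group `I = I_p ∩ Gal(ℚ̄/ℚ_∞)` of the TOWER, i.e. an element of THAT group
acting by `−1`. THIS FILE supplies it:

* §1 `mul_mem_of_isClosed_of_forall_natCast_mul_mem` — a closed subset of `ℤ_p` stable under
  multiplication by naturals is stable under multiplication by every `p`-adic integer (`ℕ` is dense in
  `ℤ_p`, `PadicInt.denseRange_natCast`);
* §2 `exists_mem_absInertia_toAdd_eq_mul` — for ANY `ℤ_p`-extension `κ` of `ℚ` and any place `v`, the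
  image of the (compact) local inertia group `I_{ℚ_v}` under `κ ∘ res` is a `ℤ_p`-SUBMODULE of `ℤ_p`:
  for `σ ∈ I_{ℚ_v}` and `a ∈ ℤ_p` there is `σ' ∈ I_{ℚ_v}` with `κ(res σ') = a · κ(res σ)` (additively);
* §3 **`exists_mem_absInertia_kappa_eq_one_smul_geomSqrt_pStar_eq_neg`** — `p` odd, `v ∣ p`: there is
  `τ ∈ I_{ℚ_v}` with `κ(res τ) = 1` (i.e. `res τ ∈ Gal(ℚ̄/ℚ_∞)`) and `res τ · √p* = −√p*`: take p10's
  `σ₀ ∈ I_{ℚ_v}` flipping `√p*` (`exists_mem_absInertia_smul_geomSqrt_pStar_eq_neg`), `σ₁ ∈ I_{ℚ_v}` with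
  `κ(res σ₁) = ½ κ(res σ₀)` (§2; `2 ∈ ℤ_pˣ`), and `τ = σ₀ σ₁⁻²` (`σ₁²` fixes `√p*`); and the
  `GreenbergSelmer` spelling `exists_mem_kerSubgroup_inf_inertia_smul_geomSqrt_pStar_eq_neg`:
  `∃ g ∈ κ.kerSubgroup ⊓ inertia v, g · √p* = −√p*`.

NOT here: the datum-level consequence `(E[p^∞]/C)^{ker κ ⊓ I_v} = 0` for the transported data (needs
the transport internals of p10/p07's constructions: "inertia acts on `D` through the sign of `√p*`";
their files' natural sequel, or mine on request).

References: Washington, GTM 83, §13.1 (the cyclotomic `ℤ_p`-extension; `ℚ_∞ ∩ ℚ(√p*) = ℚ` and total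
ramification at `p`) [cite: Washington1997, §13.1]; [GreenbergVatsal2000] §2 Remark (2.9).
-/

set_option autoImplicit false

noncomputable section

open scoped Classical NumberField

open NumberField IsDedekindDomain Field WeierstrassCurve
  Literature.NumberTheory.GaloisRepresentations Literature.NumberTheory.EllipticCurves
  Literature.NumberTheory.EllipticCurves.GreenbergSelmer

namespace Summit.BirchSwinnertonDyer.Rank1Residual.Additive

/-! ### §1 Closed `ℕ`-stable subsets of `ℤ_p` are `ℤ_p`-stable -/

/-- A closed subset of `ℤ_p` stable under multiplication by every natural number is stable under
multiplication by every `p`-adic integer (`ℕ` is dense in `ℤ_p`). [folklore] -/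
theorem mul_mem_of_isClosed_of_forall_natCast_mul_mem {p : ℕ} [Fact p.Prime] {T : Set ℤ_[p]}
    (hT : IsClosed T) {x : ℤ_[p]} (hx : ∀ n : ℕ, (n : ℤ_[p]) * x ∈ T) (a : ℤ_[p]) : a * x ∈ T := by
  have hcl : IsClosed {a : ℤ_[p] | a * x ∈ T} := hT.preimage (continuous_id.mul continuous_const)
  have hsub : Set.range (Nat.cast : ℕ → ℤ_[p]) ⊆ {a : ℤ_[p] | a * x ∈ T} := by
    rintro _ ⟨n, rfl⟩
    exact hx n
  have hmem : a ∈ closure (Set.range (Nat.cast : ℕ → ℤ_[p])) := by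
    rw [PadicInt.denseRange_natCast.closure_range]
    exact Set.mem_univ a
  exact hcl.closure_subset_iff.mpr hsub hmem

/-! ### §2 The image of a local inertia group under a `ℤ_p`-extension is a `ℤ_p`-submodule -/

section Image

variable {p : ℕ} [Fact p.Prime] (κ : ZpExtension ℚ p) (v : HeightOneSpectrum (𝓞 ℚ))

/-- **The image of the local inertia group `I_{ℚ_v} ≤ Γ_{ℚ_v}` under `κ ∘ res : Γ_{ℚ_v} → Γ_ℚ → ℤ_p`
is a `ℤ_p`-submodule of `ℤ_p`**: for `σ ∈ I_{ℚ_v}` and every `a ∈ ℤ_p` there is `σ' ∈ I_{ℚ_v}` with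
`κ(res σ') = a · κ(res σ)` (additive notation). The image is compact (`I_{ℚ_v}` is closed in the
compact `Γ_{ℚ_v}`, `isClosed_absInertia_holds`; `κ`, `res` continuous), hence closed, and stable under
`ℕ` (`σ ↦ σⁿ`); §1. [folklore] -/
theorem exists_mem_absInertia_toAdd_eq_mul {σ : absoluteGaloisGroup (v.adicCompletion ℚ)}
    (hσ : σ ∈ absInertia (v.adicCompletion ℚ)) (a : ℤ_[p]) :
    ∃ σ' ∈ absInertia (v.adicCompletion ℚ),
      Multiplicative.toAdd (κ (absGaloisRestrict ℚ (v.adicCompletion ℚ) σ')) =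
        a * Multiplicative.toAdd (κ (absGaloisRestrict ℚ (v.adicCompletion ℚ) σ)) := by
  let f : absoluteGaloisGroup (v.adicCompletion ℚ) → ℤ_[p] :=
    fun g ↦ Multiplicative.toAdd (κ (absGaloisRestrict ℚ (v.adicCompletion ℚ) g))
  have hf : Continuous f :=
    continuous_toAdd.comp
      ((map_continuous κ).comp (absGaloisRestrict ℚ (v.adicCompletion ℚ)).continuous_toFun)
  haveI : CompactSpace (absoluteGaloisGroup (v.adicCompletion ℚ)) :=
    absoluteGaloisGroup_compactSpace _
  have hT : IsClosed (f '' (absInertia (v.adicCompletion ℚ) :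
      Set (absoluteGaloisGroup (v.adicCompletion ℚ)))) :=
    ((isClosed_absInertia_holds (v.adicCompletion ℚ)).isCompact.image hf).isClosed
  have hx : ∀ n : ℕ, (n : ℤ_[p]) * f σ ∈ f '' (absInertia (v.adicCompletion ℚ) :
      Set (absoluteGaloisGroup (v.adicCompletion ℚ))) := by
    intro n
    refine ⟨σ ^ n, (absInertia _).pow_mem hσ n, ?_⟩
    change Multiplicative.toAdd (κ (absGaloisRestrict ℚ (v.adicCompletion ℚ) (σ ^ n))) =
      (n : ℤ_[p]) * Multiplicative.toAdd (κ (absGaloisRestrict ℚ (v.adicCompletion ℚ) σ))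
    rw [map_pow, map_pow, toAdd_pow, nsmul_eq_mul]
  obtain ⟨σ', hσ', h⟩ := mul_mem_of_isClosed_of_forall_natCast_mul_mem hT hx a
  exact ⟨σ', hσ', h⟩

end Image

/-! ### §3 An inertia element of the tower flipping `√p*` -/

section Flip

variable (p : ℕ) [hp : Fact p.Prime] (κ : ZpExtension ℚ p) {v : HeightOneSpectrum (𝓞 ℚ)}

/-- **An inertia element at `p` INSIDE the `ℤ_p`-tower's kernel flips `√p*`** (`p` odd, `v ∣ p`,
`p* = (−1)^{(p−1)/2} p`): there is `τ ∈ I_{ℚ_v}` with `κ(res τ) = 1` — `res τ ∈ Gal(ℚ̄/ℚ_∞)` for the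
tower `ℚ_∞` of `κ` — and `res τ · √p* = −√p*`. (`ℚ_∞(√p*)/ℚ_∞` is ramified at `p`: inside `ℚ(μ_{p^∞})`,
totally ramified.) From p10's `σ₀ ∈ I_{ℚ_v}` flipping `√p*`, `σ₁ ∈ I_{ℚ_v}` with `2κ(res σ₁) = κ(res σ₀)`
(§2, `2 ∈ ℤ_pˣ`) and `τ = σ₀ σ₁⁻²`. [cite: Washington1997, §13.1] -/
theorem exists_mem_absInertia_kappa_eq_one_smul_geomSqrt_pStar_eq_neg (hp2 : p ≠ 2)
    (hpv : ((p : ℕ) : 𝓞 ℚ) ∈ v.asIdeal) :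
    ∃ τ ∈ absInertia (v.adicCompletion ℚ),
      κ (absGaloisRestrict ℚ (v.adicCompletion ℚ) τ) = 1 ∧
        absGaloisRestrict ℚ (v.adicCompletion ℚ) τ • geomSqrt ((-1 : ℚ) ^ (p / 2) * p) =
          -geomSqrt ((-1 : ℚ) ^ (p / 2) * p) := by
  set t : AlgebraicClosure ℚ := geomSqrt ((-1 : ℚ) ^ (p / 2) * p) with ht
  obtain ⟨σ₀, hσ₀, hflip⟩ := exists_mem_absInertia_smul_geomSqrt_pStar_eq_neg p hp2 hpv
  obtain ⟨u, hu⟩ := (WeierstrassCurve.isUnit_two_padicInt (p := p) hp2).exists_left_inv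
  obtain ⟨σ₁, hσ₁, hκ₁⟩ :=
    exists_mem_absInertia_toAdd_eq_mul κ v hσ₀ u
  refine ⟨σ₀ * (σ₁ * σ₁)⁻¹, (absInertia _).mul_mem hσ₀ ((absInertia _).inv_mem
    ((absInertia _).mul_mem hσ₁ hσ₁)), ?_, ?_⟩
  · -- `κ(res τ) = κ(res σ₀) · κ(res σ₁)⁻²`, additively `x − 2·(u x) = 0`
    have e : κ (absGaloisRestrict ℚ (v.adicCompletion ℚ) (σ₀ * (σ₁ * σ₁)⁻¹)) =
        κ (absGaloisRestrict ℚ (v.adicCompletion ℚ) σ₀) *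
          (κ (absGaloisRestrict ℚ (v.adicCompletion ℚ) σ₁) *
            κ (absGaloisRestrict ℚ (v.adicCompletion ℚ) σ₁))⁻¹ := by
      rw [map_mul, map_inv, map_mul, map_mul, map_inv, map_mul]
    rw [e]
    apply Multiplicative.toAdd.injective
    rw [toAdd_one, toAdd_mul, toAdd_inv, toAdd_mul, hκ₁]
    have h2 : u * (2 : ℤ_[p]) = 1 := hu
    linear_combination
      (-(Multiplicative.toAdd (κ (absGaloisRestrict ℚ (v.adicCompletion ℚ) σ₀)))) * h2
  · -- `σ₁²` fixes `√p*`, so `τ` acts as `σ₀`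
    set g₁ := absGaloisRestrict ℚ (v.adicCompletion ℚ) σ₁ with hg₁
    have hsq : (g₁ * g₁) • t = t := by
      rw [mul_smul]
      rcases smul_geomSqrt_eq_or g₁ ((-1 : ℚ) ^ (p / 2) * p) with h | h
      · rw [← ht] at h; rw [h, h]
      · rw [← ht] at h; rw [h, smul_neg, h, neg_neg]
    rw [map_mul, map_inv, map_mul, mul_smul, ← hg₁]
    have hinv : (g₁ * g₁)⁻¹ • t = t := by
      rw [inv_smul_eq_iff, hsq]
    rw [hinv, ht]
    exact hflip

/-- **`GreenbergSelmer` spelling: an element of `ker κ ⊓ I_v` flips `√p*`** (`p` odd, `v ∣ p`): there is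
`g ∈ κ.kerSubgroup` lying in the inertia group `inertia v ≤ Γ_ℚ` (the image of `I_{ℚ_v}`) with
`g · √p* = −√p*`. This is the input that makes the quotient `E[p^∞]/C` of every twist-transported
(`e = 2`) ramified ordinary datum satisfy `D^{ker κ ⊓ I_v} = 0` (GV Remark (2.9)'s case, FILE 1's
binder `h0`). [cite: Washington1997, §13.1] [cite: GreenbergVatsal2000, §2 Remark (2.9)] -/
theorem exists_mem_kerSubgroup_inf_inertia_smul_geomSqrt_pStar_eq_neg (hp2 : p ≠ 2)
    (hpv : ((p : ℕ) : 𝓞 ℚ) ∈ v.asIdeal) :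
    ∃ g ∈ κ.kerSubgroup ⊓ inertia v,
      g • geomSqrt ((-1 : ℚ) ^ (p / 2) * p) = -geomSqrt ((-1 : ℚ) ^ (p / 2) * p) := by
  obtain ⟨τ, hτ, hκ, hflip⟩ :=
    exists_mem_absInertia_kappa_eq_one_smul_geomSqrt_pStar_eq_neg p κ hp2 hpv
  refine ⟨absGaloisRestrict ℚ (v.adicCompletion ℚ) τ, Subgroup.mem_inf.2 ⟨?_, ?_⟩, hflip⟩
  · exact ZpExtension.mem_kerSubgroup.2 hκ
  · exact Subgroup.mem_map_of_mem _ hτ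

end Flip

end Summit.BirchSwinnertonDyer.Rank1Residual.Additive

end
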